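import Literature.NumberTheory.GelbartRogawski1991.PiSCompletionIsThetaTypeTestSigned     -- ★ LH10-plan (g0): the SIGNED letter (D-b)ᵀˢ `piSCompletion_isThetaTypeAtCMTestSigned` (brings the unsigned ★ p840297)
import Literature.NumberTheory.Rogawski1990.CharIdentityOnTestFunctionsSignTransport    -- B1 «SIGN-RESCALE» (this seat): `TransferFactorData.constMul`, `LocalAPacket.charIdentityAtTest_constMul_iff`
import HarnessLib

/-!
# (D-b)ᵀ at the rescaled transfer factors `v ↦ (Δ v).constMul (ε v)` IS (D-b)ᵀˢ at `Δ` — the sign transport for «`πˢ(ξ_v)` is the `U(1)`-theta type» on test functions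
(Gelbart–Rogawski (1991) Lem. 5.1.2 p. 466, Thm. 5.1.1 p. 465; Rogawski (1990) §13.1 Prop. 13.1.4 p. 199, §4.9 p. 55, §14.6 p. 242; Langlands–Shelstad (1987) §1)

Topic `NumberTheory/GelbartRogawski1991`; namespace `Literature.NumberTheory.GelbartRogawski1991`.  THEOREMS ONLY (no definition, no instance, no notation, no named fact,
no `sorry`).  Cell `pub/hodgecm-mathlib` (D-0151), crux H413 = `stmt-HodgeConjecture-24833`; organ B1 «SIGN-RESCALE» of F0P2-ref1 (g10) objection ⑧ r353, (D-b) corollary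
for the Day-X adapter B2 (LEAD F0P3a-plan (g13) T12-14 (3): «D7αᵀ ⟸ `stubD7αMemDockPerMeasureT_of_rowsSigned` ∘ closer rows, with `Δ := Δ°` inside the node's ∃»); seat
F0P2-p06 (g14).  HONEST LABEL: HC_CM is proved only modulo the printed citations (2 remaining named inputs hLiu418, h413) until rung 0 closes; this file proves no printed
statement — it identifies two spellings of the same print letter.

THE POINT.  ★ `piSCompletion_isThetaTypeAtCMTest` (p840297, UNSIGNED member traces) and ★ `piSCompletion_isThetaTypeAtCMTestSigned` (LH10, member traces scaled by the
clause sign `ε_v(a) = (if ∃ z, IsUnit z ∧ a = z·σz then 1 else −1)` of the frame multiplier) have byte-identical binder blocks and differ in exactly that one token under the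
per-frame `∃ ε πθ`.  By ★ `LocalAPacket.charIdentityAtTest_constMul_iff` (B1 §2: `(f^H, f)` is `(ε·Δ)`-matched iff `(ε·f^H, f)` is `Δ`-matched, `χ_ξ(ε f^H) = ε χ_ξ(f^H)`,
`C_c^∞` is scalar-stable) the unsigned identity at `Δ_v.constMul ε` is the signed identity at `Δ_v` for any sign `ε` (`ε·ε = 1`); so for ANY sign family `ε : v ↦ ℂ` that
equals the clause sign at every frame of every non-split `v` (the frame-independent form sign `formSignAt` of LH7 — «`a ≡ −det H` mod norms»), the UNSIGNED letter at the
rescaled family `Δ° := fun v => (Δ v).constMul (ε v)` is EQUIVALENT to the SIGNED letter at `Δ`.  The letter quantifies over non-split `v` only, so no split-place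
hypothesis on `ε` is needed.  Generic in `ε`; this file does not choose it.

* **`piSCompletion_isThetaTypeAtCMTest_constMul_iff_signed`** — `piSCompletion_isThetaTypeAtCMTest L H (fun v => (Δ v).constMul (ε v)) mH mG νH νG ξ μω ξloc e₁ dV hdV hdV0 g hg ↔
  piSCompletion_isThetaTypeAtCMTestSigned L H Δ mH mG νH νG ξ μω ξloc e₁ dV hdV hdV0 g hg` under `hεn` (ε agrees with the clause sign at every non-split frame).
* `piSCompletion_isThetaTypeAtCMTest_constMul_of_signed` — the direction the Day-X adapter uses ((H₈ᵀ) at `Δ°` from (D-b)ᵀˢ at `Δ‴`).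

## References
* [GelbartRogawski1991] S. Gelbart, J. Rogawski, Invent. Math. 105 (1991): §5.1 Thm. 5.1.1 p. 465, Lem. 5.1.2 p. 466.
* [Rogawski1990] J. D. Rogawski, Ann. of Math. Stud. 123 (1990): §13.1 Prop. 13.1.3 (d), Prop. 13.1.4 p. 199; §4.9 p. 55; §14.6 p. 242.
* [LanglandsShelstad1987] R. P. Langlands, D. Shelstad, Math. Ann. 278 (1987): §1.
-/

set_option autoImplicit false

noncomputable section

open NumberField IsDedekindDomain MeasureTheory
open scoped Matrix ComplexOrder

namespace Literature.NumberTheory.GelbartRogawski1991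

open Literature.NumberTheory Literature.NumberTheory.Automorphic Literature.NumberTheory.Automorphic.UnitaryGroup
open Literature.NumberTheory.Automorphic.IdeleClassGroup
open Literature.NumberTheory.Automorphic.Liu2021 Literature.NumberTheory.Automorphic.Liu2021.Def411WeilCarriers
open Literature.NumberTheory.GaloisRepresentations
open Literature.NumberTheory.Rogawski1990

variable (L : Type) [Field L] [NumberField L] [IsCMField L] (H : Matrix (Fin 3) (Fin 3) L)

variable
    [∀ v : HeightOneSpectrum (𝓞 ↥(maximalRealSubfield L)), MeasurableSpace ((cmDatum L 3 H).Local v)]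
    [∀ v : HeightOneSpectrum (𝓞 ↥(maximalRealSubfield L)),
      MeasurableSpace ((cmDatum L 2 (Matrix.of fun i j : Fin 2 => if i.val + j.val + 1 = 2 then (1 : L) else 0)).Local v ×
        (cmDatum L 1 (Matrix.of fun i j : Fin 1 => if i.val + j.val + 1 = 1 then (1 : L) else 0)).Local v)]
    [∀ (v : HeightOneSpectrum (𝓞 ↥(maximalRealSubfield L)))
        (a : ((cmDatum L 2 (Matrix.of fun i j : Fin 2 => if i.val + j.val + 1 = 2 then (1 : L) else 0)).Local v ×
          (cmDatum L 1 (Matrix.of fun i j : Fin 1 => if i.val + j.val + 1 = 1 then (1 : L) else 0)).Local v)),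
      MeasurableSpace (((cmDatum L 2 (Matrix.of fun i j : Fin 2 => if i.val + j.val + 1 = 2 then (1 : L) else 0)).Local v ×
          (cmDatum L 1 (Matrix.of fun i j : Fin 1 => if i.val + j.val + 1 = 1 then (1 : L) else 0)).Local v) ⧸
        Subgroup.centralizer ({a} : Set ((cmDatum L 2 (Matrix.of fun i j : Fin 2 => if i.val + j.val + 1 = 2 then (1 : L) else 0)).Local v ×
          (cmDatum L 1 (Matrix.of fun i j : Fin 1 => if i.val + j.val + 1 = 1 then (1 : L) else 0)).Local v)))]
    [∀ (v : HeightOneSpectrum (𝓞 ↥(maximalRealSubfield L))) (γ : (cmDatum L 3 H).Local v),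
      MeasurableSpace ((cmDatum L 3 H).Local v ⧸ Subgroup.centralizer ({γ} : Set ((cmDatum L 3 H).Local v)))]
    (Δ : ∀ v : HeightOneSpectrum (𝓞 ↥(maximalRealSubfield L)), LocalTransferFactor L H v)
    (mH : ∀ v : HeightOneSpectrum (𝓞 ↥(maximalRealSubfield L)),
      OrbitalMeasureFamily ((cmDatum L 2 (Matrix.of fun i j : Fin 2 => if i.val + j.val + 1 = 2 then (1 : L) else 0)).Local v ×
        (cmDatum L 1 (Matrix.of fun i j : Fin 1 => if i.val + j.val + 1 = 1 then (1 : L) else 0)).Local v))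
    (mG : ∀ v : HeightOneSpectrum (𝓞 ↥(maximalRealSubfield L)), OrbitalMeasureFamily ((cmDatum L 3 H).Local v))
    (νH : ∀ v : HeightOneSpectrum (𝓞 ↥(maximalRealSubfield L)),
      Measure ((cmDatum L 2 (Matrix.of fun i j : Fin 2 => if i.val + j.val + 1 = 2 then (1 : L) else 0)).Local v ×
        (cmDatum L 1 (Matrix.of fun i j : Fin 1 => if i.val + j.val + 1 = 1 then (1 : L) else 0)).Local v))
    (νG : ∀ v : HeightOneSpectrum (𝓞 ↥(maximalRealSubfield L)), Measure ((cmDatum L 3 H).Local v))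
    (ξ : OneDimAutRepH L) (μω : HeckeCharacter L)
    (ξloc : ∀ v : HeightOneSpectrum (𝓞 ↥(maximalRealSubfield L)),
      (cmDatum L 2 (Matrix.of fun i j : Fin 2 => if i.val + j.val + 1 = 2 then (1 : L) else 0)).Local v ×
        (cmDatum L 1 (Matrix.of fun i j : Fin 1 => if i.val + j.val + 1 = 1 then (1 : L) else 0)).Local v →* ℂˣ)
    {n' : ℕ} (e₁ : Fin 3 × Fin 1 ≃ Fin n') (dV : Fin 3 → L) (hdV : ∀ i, IsCMField.complexConj L (dV i) = dV i) (hdV0 : ∀ i, dV i ≠ 0) (g : GL (Fin 3) L)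
    (hg : ((g : Matrix (Fin 3) (Fin 3) L).map (cmConjRingHom L))ᵀ * H * (g : Matrix (Fin 3) (Fin 3) L) = Matrix.diagonal dV)
    (ε : HeightOneSpectrum (𝓞 ↥(maximalRealSubfield L)) → ℂ)

open scoped Classical in
/-- **(D-b)ᵀ AT THE RESCALED FAMILY `v ↦ (Δ v).constMul (ε v)` ⟺ (D-b)ᵀˢ AT `Δ`.**  For a sign family `ε : v ↦ ℂ` that equals the clause sign
`(if ∃ z, IsUnit z ∧ a = z · σ z then 1 else −1)` of EVERY frame `ᵗσT · H_v · T = a · Φ₃` at every non-split `v` (the form sign `ε_v(H) = ω_{L_w∕L⁺_v}(−det H)`, frame-independent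
since `a ≡ −det H` modulo norms):
`piSCompletion_isThetaTypeAtCMTest L H (fun v => (Δ v).constMul (ε v)) … ↔ piSCompletion_isThetaTypeAtCMTestSigned L H Δ …` — the two letters have byte-identical binders and
differ by the one member-trace token, which ★ `LocalAPacket.charIdentityAtTest_constMul_iff` moves between the factor and the traces (`ε · ε = 1`).
[cite: GelbartRogawski1991, Lem. 5.1.2 p. 466; Thm. 5.1.1 p. 465] [cite: Rogawski1990, §13.1 Prop. 13.1.4 p. 199; §14.6 p. 242] [cite: LanglandsShelstad1987, §1] -/
theorem piSCompletion_isThetaTypeAtCMTest_constMul_iff_signed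
    (hεn : ∀ v : HeightOneSpectrum (𝓞 ↥(maximalRealSubfield L)), (∀ w : PlacesOver L v, IsCMField.complexConj L • w.1 = w.1) →
      ∀ (T : GL (Fin 3) (LocalRing L v)) (a : LocalRing L v), IsUnit a →
        formCongr (conjLocal L (IsCMField.complexConj L) v) T (H.map (algebraMap L (LocalRing L v))) =
          a • (Matrix.of fun i j : Fin 3 => if i.val + j.val + 1 = 3 then (1 : L) else 0).map (algebraMap L (LocalRing L v)) →
        (if ∃ z : LocalRing L v, IsUnit z ∧ a = z * conjLocal L (IsCMField.complexConj L) v z then (1 : ℂ) else -1) = ε v) :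
    piSCompletion_isThetaTypeAtCMTest L H (fun v => (Δ v).constMul (ε v)) mH mG νH νG ξ μω ξloc e₁ dV hdV hdV0 g hg ↔
      piSCompletion_isThetaTypeAtCMTestSigned L H Δ mH mG νH νG ξ μω ξloc e₁ dV hdV hdV0 g hg := by
  refine forall_congr' fun μ => forall_congr' fun hμ => forall_congr' fun χf => forall_congr' fun _ => forall_congr' fun _ =>
    forall_congr' fun _ => forall_congr' fun _ => forall_congr' fun v => forall_congr' fun hns => forall_congr' fun T => forall_congr' fun a =>
    forall_congr' fun ha => forall_congr' fun h => forall_congr' fun _ => forall_congr' fun _ => forall_congr' fun μZ => forall_congr' fun _ =>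
    forall_congr' fun π2 => forall_congr' fun πn => forall_congr' fun _ => forall_congr' fun _ => exists_congr fun ε' => exists_congr fun πθ =>
    and_congr ?_ Iff.rfl
  have hsign : (if ∃ z : LocalRing L v, IsUnit z ∧ a = z * conjLocal L (IsCMField.complexConj L) v z then (1 : ℂ) else -1) *
      (if ∃ z : LocalRing L v, IsUnit z ∧ a = z * conjLocal L (IsCMField.complexConj L) v z then (1 : ℂ) else -1) = 1 := by
    split_ifs <;> norm_num
  dsimp only
  rw [← hεn v hns T a ha h]
  exact LocalAPacket.charIdentityAtTest_constMul_iff L H v _ (fun c f => c.smoothTrace (νG v) f) (ξloc v) (νH v) (Δ v) (mH v) (mG v) hsign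

open scoped Classical in
/-- **The direction the Day-X adapter uses**: (D-b)ᵀˢ at the factor of record `Δ` (= `Δ‴`) gives the UNSIGNED (D-b)ᵀ — the (H₈ᵀ) hypothesis of ★
`F0P2oD7alphaMemDockOfRowsT.stubD7αMemDockPerMeasureT_of_rows` — at print's factor `Δ° := fun v => (Δ v).constMul (ε v)`.
[cite: GelbartRogawski1991, Lem. 5.1.2 p. 466; Thm. 5.1.1 p. 465] [cite: Rogawski1990, §13.1 Prop. 13.1.4 p. 199; §14.6 p. 242] -/
theorem piSCompletion_isThetaTypeAtCMTest_constMul_of_signed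
    (hεn : ∀ v : HeightOneSpectrum (𝓞 ↥(maximalRealSubfield L)), (∀ w : PlacesOver L v, IsCMField.complexConj L • w.1 = w.1) →
      ∀ (T : GL (Fin 3) (LocalRing L v)) (a : LocalRing L v), IsUnit a →
        formCongr (conjLocal L (IsCMField.complexConj L) v) T (H.map (algebraMap L (LocalRing L v))) =
          a • (Matrix.of fun i j : Fin 3 => if i.val + j.val + 1 = 3 then (1 : L) else 0).map (algebraMap L (LocalRing L v)) →
        (if ∃ z : LocalRing L v, IsUnit z ∧ a = z * conjLocal L (IsCMField.complexConj L) v z then (1 : ℂ) else -1) = ε v)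
    (hS : piSCompletion_isThetaTypeAtCMTestSigned L H Δ mH mG νH νG ξ μω ξloc e₁ dV hdV hdV0 g hg) :
    piSCompletion_isThetaTypeAtCMTest L H (fun v => (Δ v).constMul (ε v)) mH mG νH νG ξ μω ξloc e₁ dV hdV hdV0 g hg :=
  (piSCompletion_isThetaTypeAtCMTest_constMul_iff_signed L H Δ mH mG νH νG ξ μω ξloc e₁ dV hdV hdV0 g hg ε hεn).2 hS

end Literature.NumberTheory.GelbartRogawski1991

end
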